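/-
Copyright (c) 2026 the pub-hodgecm-mathlib formalisation cell (harness21).  Prover seat hodgecm-mathlib-K2E3-p23 (g3), Track B «K2-LIT» ∕ h413
(`stmt-HodgeConjecture-24833`), line `K2_E3_EllipticInputs`, 13a road A (line lead K2E3-p10 (g3)), item (D2) «Witt–Iwasawa for a normalised
anisotropic kernel», file F2b.  2026-09-04.
-/
import Summits.HodgeConjecture.HodgeConjecture.Theorems.K2E3WittIntegralMoves     -- F2a (this seat): the three moves of `K₀` (permutation, diagonal, Eichler)
import HarnessLib

/-!
# Crux `H413` — K2-LIT E3 «EllipticInputs», 13a road A, item (D2) F2b: `K₀ = U(σ, W) ∩ GL_N(𝒪)` IS TRANSITIVE ON THE PRIMITIVE ISOTROPIC VECTORS OF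
# `𝒪^N` for a Witt form `W = wittFormOn e Han` with INTEGRAL hermitian kernel (any `m`), inside any `rev`-stable frame containing the kernel

Cell `hodgecm-mathlib`, Track B «K2-LIT», crux item `stmt-HodgeConjecture-24833` (h413), socket U12-g ‹13a› road A.  Item (D2), file F2b (F1 = ★
`K2E3WittHermFormStd`, F2a = ★ `K2E3WittIntegralMoves`; F3 = the flag induction `U(σ, W) = P_S · K₀`).  The `m`-kernel twin of ★
`HermitianLattice.exists_mem_unitaryInt_mulVec_single_eq` (`J₀` only), at the GROUP level `↥(unitaryGroupOfForm σ W)` ∕ ★ `unitaryInt σ W`.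

SETTING.  `K` a field with `Valued K ℤᵐ⁰`, `σ` an involution preserving `v` (`hσ`, `hvσ`), `e : WittIndex r m ≃ Fin N` standard (`hstd`), `Han` a
`σ`-hermitian (`hHan`) INTEGRAL (`hint`) kernel; `W = wittFormOn e Han`, `K₀ = unitaryInt σ W`; hyperbolic position `a.val < r ∨ r + m ≤ a.val`.

* **`exists_mem_unitaryInt_mulVec_single_eq_witt`**: for a `rev`-stable `S ⊆ Fin N` containing the kernel positions, `x ∈ 𝒪^N ∩ K^S` isotropic with a
  unit coordinate at a hyperbolic position, and a hyperbolic `i₀ ∈ S`, there is `k ∈ K₀` with `k e_{i₀} = x` and `k e_l = e_l` for every `l ∉ S`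
  (`k = T · D · P`: ★ `exists_perm_comm_rev_apply_eq` + F2a).

`--supports stmt-HodgeConjecture-24833 --as helper`.  THEOREMS ONLY — no `def`, no named fact, no instance, no notation, no `sorry`.  HONEST LABEL: HC_CM is
proved only modulo the 7 printed citations (2 remaining named inputs: hLiu418 = stmt-HodgeConjecture-24832, h413 = stmt-HodgeConjecture-24833) until rung 0
closes; unconditional local algebra, closes no organ by itself.

## References
* [BruhatTits1972] F. Bruhat, J. Tits, *Groupes réductifs sur un corps local I*, Publ. Math. IHÉS 41 (1972), (4.4.3).
* [Tits1979] J. Tits, *Reductive groups over local fields*, Proc. Symp. Pure Math. 33.1 (1979), §3.3.3.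
* [Omeara1963] O. T. O'Meara, *Introduction to Quadratic Forms* (1963), §82F.
-/

set_option autoImplicit false
-- the mandated namespace repeats `HodgeConjecture.HodgeConjecture`, as in every `Theorems/*.lean` of this sub-problem
set_option linter.dupNamespace false

noncomputable section

open scoped Matrix MatrixGroups Valued WithZero
open Matrix

namespace Summit.HodgeConjecture.HodgeConjecture.Cruxes.H413.K2E3WittIntegralTransitive

open Literature.NumberTheory.Automorphic Literature.NumberTheory.Automorphic.UnitaryGroup Literature.NumberTheory.Automorphic.HermitianLattice
open K2E3LocalUnitaryWitt K2E3WittCartanUnramified K2E3WittParabolicBlocks K2E3WittHermFormStd K2E3WittIntegralMoves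

/-! ## `K₀` is transitive on primitive isotropic vectors inside a `rev`-stable frame containing the kernel -/

section Transitive

variable {K : Type*} [Field K] [Valued K ℤᵐ⁰] (σ : K →+* K) {N r m : ℕ} (e : WittIndex r m ≃ Fin N)
  (hstd : ∀ x, (e x).val = Sum.elim (fun i : Fin r => i.val) (Sum.elim (fun u : Fin m => r + u.val) (fun j : Fin r => r + m + j.val)) x)
  (Han : Matrix (Fin m) (Fin m) K)

include hstd in
/-- **`K₀ = U(σ, W) ∩ GL_N(𝒪)` IS TRANSITIVE ON THE PRIMITIVE ISOTROPIC VECTORS OF `𝒪^N`, inside a frame.**  Let `S ⊆ Fin N` be `rev`-stable and contain every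
kernel position, `x ∈ 𝒪^N ∩ K^S` be `W`-isotropic with a unit coordinate at a HYPERBOLIC position, and `i₀ ∈ S` hyperbolic.  Then some `k ∈ K₀` maps
`e_{i₀} ↦ x` and fixes `e_l` for every `l ∉ S`: `k = T · D · P` with `P = P_τ` (`τ` commuting with `rev`, `τ j = i₀`, fixing everything off
`{j, rev j, i₀, rev i₀}` — ★ `exists_perm_comm_rev_apply_eq`), `D = diag(x_j at j, (σ x_j)⁻¹ at rev j)`, `T` the Eichler move `e_j ↦ x_j⁻¹ x`.
(`σ` an involution preserving `v`; `Han` hermitian and integral; every residue characteristic, ramified places included.)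
[cite: Omeara1963, §82F] [cite: Tits1979, §3.3.3] [cite: BruhatTits1972, (4.4.3)] -/
theorem exists_mem_unitaryInt_mulVec_single_eq_witt (hσ : ∀ a, σ (σ a) = a) (hvσ : ∀ a, Valued.v (σ a) = Valued.v a)
    (hHan : (Han.map σ)ᵀ = Han) (hint : ∀ u u', Valued.v (Han u u') ≤ 1)
    {S : Finset (Fin N)} (hS : ∀ i ∈ S, Fin.rev i ∈ S) (hSk : ∀ a : Fin N, r ≤ a.val → a.val < r + m → a ∈ S)
    {x : Fin N → K} (hxL : x ∈ stdLattice K N) (hxS : x ∈ frame K N S) (hunit : ∃ a : Fin N, (a.val < r ∨ r + m ≤ a.val) ∧ Valued.v (x a) = 1)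
    (hiso : hermForm σ (wittFormOn e Han) x x = 0) {i₀ : Fin N} (hi₀S : i₀ ∈ S) (hi₀ : i₀.val < r ∨ r + m ≤ i₀.val) :
    ∃ k : unitaryGroupOfForm σ (wittFormOn e Han), k ∈ unitaryInt σ (wittFormOn e Han) ∧
      (∀ l, l ∉ S → ((k : GL (Fin N) K) : Matrix (Fin N) (Fin N) K) *ᵥ Pi.single l 1 = Pi.single l 1) ∧
      ((k : GL (Fin N) K) : Matrix (Fin N) (Fin N) K) *ᵥ Pi.single i₀ 1 = x := by
  obtain ⟨j, hj, hju⟩ := hunit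
  have hjS : j ∈ S := by
    by_contra h
    rw [hxS j h, map_zero] at hju
    exact zero_ne_one hju
  have hjr : Fin.rev j ≠ j := rev_ne_of_hyperbolic e hj
  have hi₀r : Fin.rev i₀ ≠ i₀ := rev_ne_of_hyperbolic e hi₀
  have hu0 : x j ≠ 0 := ne_zero_of_v_eq_one hju
  -- `x' = x_j⁻¹ x`
  obtain ⟨x', hx'⟩ : ∃ x' : Fin N → K, (x j)⁻¹ • x = x' := ⟨_, rfl⟩
  have hx'1 : x' j = 1 := by rw [← hx', Pi.smul_apply, smul_eq_mul, inv_mul_cancel₀ hu0]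
  have hx'0 : hermForm σ (wittFormOn e Han) x' x' = 0 := by rw [← hx']; exact hermForm_smul_smul_self_eq_zero σ _ hiso _
  have hx'L : x' ∈ stdLattice K N := by rw [← hx']; exact smul_mem_of_v_le _ (by rw [map_inv₀, hju, inv_one]) hxL
  have hx'S : x' ∈ frame K N S := by rw [← hx']; exact (frame K N S).smul_mem _ hxS
  have hxx' : x = x j • x' := by rw [← hx', smul_smul, mul_inv_cancel₀ hu0, one_smul]
  -- (P) the permutation `τ j = i₀`
  obtain ⟨τ, hτ, hτj, hτfix⟩ := exists_perm_comm_rev_apply_eq hjr hi₀r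
  have hτk : ∀ a : Fin N, r ≤ a.val → a.val < r + m → τ a = a := by
    intro a h₁ h₂
    refine hτfix a ?_ ?_ ?_ ?_
    · rintro rfl; omega
    · rintro rfl; have := rev_hyperbolic e hj; omega
    · rintro rfl; omega
    · rintro rfl; have := rev_hyperbolic e hi₀; omega
  have hτS : ∀ l, l ∉ S → τ l = l := fun l hl =>
    hτfix l (fun h => hl (h ▸ hjS)) (fun h => hl (h ▸ hS j hjS)) (fun h => hl (h ▸ hi₀S)) (fun h => hl (h ▸ hS i₀ hi₀S))
  obtain ⟨P, hP⟩ : ∃ P : unitaryGroupOfForm σ (wittFormOn e Han), P = ⟨permGL τ, permGL_mem_unitary_witt σ e hstd Han hτ hτk⟩ := ⟨_, rfl⟩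
  have hPK : P ∈ unitaryInt σ (wittFormOn e Han) := by rw [hP]; exact permGL_mem_unitaryInt_witt σ e hstd Han hτ hτk
  have hPe : ∀ l, ((P : GL (Fin N) K) : Matrix (Fin N) (Fin N) K) *ᵥ Pi.single l 1 = Pi.single (τ.symm l) 1 := fun l => by
    rw [hP]; exact permGL_mulVec_single τ l
  -- (D) the diagonal `x_j` at `j`, `(σ x_j)⁻¹` at `rev j`
  obtain ⟨d, hd⟩ : ∃ d : Fin N → Kˣ, d = fun l => if l = j then Units.mk0 (x j) hu0 else
      if l = Fin.rev j then (Units.map (σ : K →* K) (Units.mk0 (x j) hu0))⁻¹ else 1 := ⟨_, rfl⟩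
  have hdj : d j = Units.mk0 (x j) hu0 := by rw [hd]; exact if_pos rfl
  have hdj' : d (Fin.rev j) = (Units.map (σ : K →* K) (Units.mk0 (x j) hu0))⁻¹ := by rw [hd]; dsimp only; rw [if_neg hjr, if_pos rfl]
  have hdl : ∀ l, l ≠ j → l ≠ Fin.rev j → d l = 1 := fun l h1 h2 => by rw [hd]; dsimp only; rw [if_neg h1, if_neg h2]
  have hdv : ∀ l, Valued.v (d l : K) = 1 := fun l => by
    by_cases h1 : l = j
    · rw [h1, hdj, Units.val_mk0, hju]
    by_cases h2 : l = Fin.rev j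
    · rw [h2, hdj', Units.val_inv_eq_inv_val, Units.coe_map, MonoidHom.coe_coe, Units.val_mk0, map_inv₀, hvσ, hju, inv_one]
    · rw [hdl l h1 h2, Units.val_one, map_one]
  have hDmem := glDiagonal_mem_unitary_witt σ e hstd Han hσ hj (Units.mk0 (x j) hu0) hdj hdj' hdl
  obtain ⟨D, hD⟩ : ∃ D : unitaryGroupOfForm σ (wittFormOn e Han), D = ⟨glDiagonal N K d, hDmem⟩ := ⟨_, rfl⟩
  have hDK : D ∈ unitaryInt σ (wittFormOn e Han) := by rw [hD]; exact glDiagonal_mem_unitaryInt_of_v_eq_one σ e Han hdv hDmem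
  have hDe : ∀ l, ((D : GL (Fin N) K) : Matrix (Fin N) (Fin N) K) *ᵥ Pi.single l 1 = (d l : K) • Pi.single l 1 := fun l => by
    rw [hD]; exact glDiagonal_mulVec_single d l
  -- (T) the Eichler move `e_j ↦ x'`
  obtain ⟨T, hT⟩ : ∃ T : unitaryGroupOfForm σ (wittFormOn e Han), T = ⟨_, lineRootGL_mem_unitary_witt σ e hstd Han hσ hHan hj hx'1 hx'0⟩ := ⟨_, rfl⟩
  have hTK : T ∈ unitaryInt σ (wittFormOn e Han) := by rw [hT]; exact lineRootGL_mem_unitaryInt_witt σ e hstd Han hσ hvσ hHan hint hj hx'L hx'1 hx'0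
  have hTj : ((T : GL (Fin N) K) : Matrix (Fin N) (Fin N) K) *ᵥ Pi.single j 1 = x' := by
    rw [hT]; exact lineRoot_mulVec_single_self σ e hstd Han hj x'
  have hTl : ∀ l, l ∉ S → ((T : GL (Fin N) K) : Matrix (Fin N) (Fin N) K) *ᵥ Pi.single l 1 = Pi.single l 1 := by
    intro l hl
    have hlh : l.val < r ∨ r + m ≤ l.val := by by_contra h; exact hl (hSk l (by omega) (by omega))
    have hlj : l ≠ j := fun h => hl (h ▸ hjS)
    have hrl : Fin.rev l ∉ S := fun h => hl (by rw [← Fin.rev_rev l]; exact hS _ h)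
    rw [hT]; exact lineRoot_mulVec_single_of_ne σ e hstd Han hj hx'1 _ hlh hlj (hx'S _ hrl)
  -- `k = T D P`
  refine ⟨T * D * P, (unitaryInt σ _).mul_mem ((unitaryInt σ _).mul_mem hTK hDK) hPK, fun l hl => ?_, ?_⟩
  · have hlj : l ≠ j := fun h => hl (h ▸ hjS)
    have hlj' : l ≠ Fin.rev j := fun h => hl (h ▸ hS j hjS)
    have hτl : τ.symm l = l := by rw [Equiv.symm_apply_eq]; exact (hτS l hl).symm
    rw [mul_mulVec, mul_mulVec, hPe, hτl, hDe, hdl l hlj hlj', Units.val_one, one_smul, hTl l hl]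
  · have hτi₀ : τ.symm i₀ = j := by rw [Equiv.symm_apply_eq]; exact hτj.symm
    rw [mul_mulVec, mul_mulVec, hPe, hτi₀, hDe, hdj, Units.val_mk0, Matrix.mulVec_smul, hTj, ← hxx']

end Transitive

end Summit.HodgeConjecture.HodgeConjecture.Cruxes.H413.K2E3WittIntegralTransitive

end
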